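import Summits.Ventures.GridStability.Bench.NE39SPSlabCMain
import Summits.Ventures.GridStability.Lyapunov.NE39SPSlabCRank
import Literature.MathematicalPhysics.PowerSystems.LuriePostnikovSlabInstanceForms

/-!
# GridStability/Bench/NE39SPSlabCRankOne — rider «#53″ LEVEL» of ★ #53 «G2.b-NE39SP-SLAB-CLQ»: the RANK-ONE level of the
# same certificate (`c_max = 18818/163315625` instead of the ε-level `4506911/1342177280000`, ≈ 34×)

Cell `gridfusion` (LADDER-GRIDFUSION), SP–Lur'e lane; seat gridfusion-model-2 (g6); lead g5 BATCH 3 (2) («#53″» after the row's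
MAIN, which is p523789). OBJECT: the row's certificate `cert` (sos-4 3f9f274c5104abf6 / hand-over 5a053876f8a67723 on model-2's
`Lyapunov/NE39SPSlabCData` p514683) — UNCHANGED; what changes is the LEVEL: sos-1's uniform rank-one object (pack
cert/A/NE39SP-D1o10-A-rankone-uniform-ROW-3f9f274c.handover.json 9da517388f818411; `s = 261305/128`, `c_max = 18818/163315625`,
`c_max·s ≤ (97/200)²`) typed and Gram-certified by sos-4 as `Lyapunov/NE39SPSlabCRank` p524824 (`RkS` = the clique-certified PSD
matrix, `rkS_posSemidef`, `rank_scalar_facts`). THIS FILE (model-2): the exact identity `s·P − CᵀC = RkS` over `ℚ` (sparse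
contraction of `CᵀC` through `Bench/NE39SPSlabCSparse`'s decided lists; 58 rows in two kernel blocks), hence the AGGREGATE fact
`s·P − CᵀC ⪰ 0` over `ℝ` for `cert`, hence the 56 rank-one level facts by lit-6's `SlabCertificate.rankOne_of_aggregate` (p517250,
[cite: HornJohnson2013, §7.1 Observation 7.1.3]), hence the sentence by model-2's `NE39SP.slab_roa_of_rankOne` (p506543).
THREE COLUMNS. CERTIFIED: the sentence of `ne39_slab_roa_rankOne` — same MODEL M′_D, same window `|σ_e − σ*_e| ≤ 97/200`, same slab
class `u = 1/4`, level `c_max = 18818/163315625` («containment by the rank-one facts, not by ε»). MODELLED (tokens of record,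
MODEL-VALIDITY v0.38 (b)): «MV-3 + lossless + MV-P + D⟨declared: SYNTHETIC uniform D′ = 1/10⟩ + 60-Hz base (ω_s := 377) + V-frozen(LF)
+ |E|′(h12) + ref bus 39; pipeline object with DECLARED SYNTHETIC DAMPING (37.7× the printed generic prime-mover coefficient)» — a
structure-preserving NE39 VARIANT, not a sentence about the printed New England system. VALIDATED: sos-1's exact checker (A,
j274186 incl. the 56 facts), sos-2 (B 09:06:52Z); the inner-ball reading of `c_max` is a VALIDATED datum, never a stability margin.
Nothing here says the New England system or any grid is stable.
-/

noncomputable section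

open Set Filter Topology Real Matrix
open Literature.MathematicalPhysics.PowerSystems
open Literature.MathematicalPhysics.PowerSystems.LyapunovFunctionFamily
open Literature.Computation.Certificates
open Summit.Ventures.GridStability.Models
open Summit.Ventures.GridStability.Models.StructurePreserving
open Summit.Ventures.GridStability.Models.NE39SP
open Summit.Ventures.GridStability.Lyapunov.NE39SPSlabC

namespace Summit.Ventures.GridStability.Bench.NE39SPSlabC

/-! ### `CᵀC` sparsely and the identity `s·P − CᵀC = RkS` over `ℚ` -/

/-- `(CᵀC)_ij`, contracted over the nonzeros of `C`. -/
def CtC (i j : Fin 48 ⊕ Fin 10) : ℚ := ((colsC i).map fun ec => ec.2 * lsum (rowsC ec.1) j).sum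

/-- `CᵀC` sparsely. -/
theorem CtC_eq : CQᵀ * CQ = Matrix.of CtC := by
  ext i j
  rw [Matrix.mul_apply, Matrix.of_apply, CtC]
  simp only [hCcT, hCr]
  exact sum_lsum_mul _ _

/-- identity row `p` of `s·P − CᵀC = RkS` (state index flattened by `e1`). -/
def IdRk (p : Fin 58) : Prop := ∀ q : Fin 58, sS * PSq p q - CtC (e1.symm p) (e1.symm q) = RkS p q

/-- `IdRk p` is decidable (a finite conjunction of rational equalities). -/
instance (p : Fin 58) : Decidable (IdRk p) := by unfold IdRk; infer_instance

set_option maxHeartbeats 400000 in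
/-- rows `0…28` of `s·P − CᵀC = RkS` (kernel decide over `ℚ`). -/
theorem idrk_0 : ∀ p : Fin 58, 29 * (0 : ℕ) ≤ p.val → p.val < 29 * ((0 : ℕ) + 1) → IdRk p := by
  decide +kernel

set_option maxHeartbeats 400000 in
/-- rows `29…57` of `s·P − CᵀC = RkS` (kernel decide over `ℚ`). -/
theorem idrk_1 : ∀ p : Fin 58, 29 * (1 : ℕ) ≤ p.val → p.val < 29 * ((1 : ℕ) + 1) → IdRk p := by
  decide +kernel

/-- all 58 rows. -/
theorem idRkAll : ∀ p : Fin 58, IdRk p :=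
  forall_fin_of_blocks 29 (by norm_num) fun c => by
    fin_cases c
    exacts [idrk_0, idrk_1]

/-- **`s·P − CᵀC = RkS`** over `ℚ` on the state index type. -/
theorem rk_identity : sS • PQB - CQᵀ * CQ = RkS.submatrix e1 e1 := by
  rw [CtC_eq]
  ext a b
  have h := idRkAll (e1 a) (e1 b)
  simp only [Equiv.symm_apply_apply] at h
  simpa [PQB, Matrix.submatrix] using h

/-! ### The aggregate fact over `ℝ`, the 56 rank-one facts, the sentence -/

/-- **the aggregate rank-one fact** `s·P − CᵀC ⪰ 0` for the row's certificate `cert`. -/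
theorem aggregate_posSemidef :
    ((sS : ℝ) • cert.P - (NE39SP.relLurie D).Cᵀ * (NE39SP.relLurie D).C).PosSemidef := by
  have h1 : (sS : ℝ) • cert.P - (NE39SP.relLurie D).Cᵀ * (NE39SP.relLurie D).C
      = (sS • PQB - CQᵀ * CQ).map (Rat.cast : ℚ → ℝ) := by
    rw [C_eq]
    show (sS : ℝ) • PQB.map (Rat.cast : ℚ → ℝ) - _ = _
    ext i j
    simp only [Matrix.map_apply, Matrix.sub_apply, Matrix.smul_apply, smul_eq_mul, Matrix.mul_apply,
      Matrix.transpose_apply, Rat.cast_sub, Rat.cast_mul, Rat.cast_sum]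
  rw [h1, rk_identity]
  exact (Matrix.posSemidef_submatrix_equiv e1).2 rkS_posSemidef

/-- the 56 uniform rank-one level facts `s·P − C_eᵀC_e ⪰ 0` for `cert` (lit-6 `SlabCertificate.rankOne_of_aggregate`,
[cite: HornJohnson2013, §7.1 Observation 7.1.3]). -/
theorem rankOne_facts : ∀ e, ((sS : ℝ) • cert.P
    - Matrix.vecMulVec ((NE39SP.relLurie D).C e) ((NE39SP.relLurie D).C e)).PosSemidef :=
  SlabCertificate.rankOne_of_aggregate cert aggregate_posSemidef

/-- **«#53″ LEVEL» — the RANK-ONE level sentence of ★ #53's certificate.** For every phase point `y = (δ, ω)` of MODEL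
M′_D = `(NE39SP.params D).phaseField` (`D = 1/10` DECLARED SYNTHETIC) whose 56 listed line-angle deviations satisfy
`|σ_e − σ*_e| ≤ 97/200` and whose relative state has `V(relState y) ≤ c_max = 18818/163315625` (`V` of `cert`): a solution
from `y` exists and EVERY solution keeps `|σ_e(t) − σ*_e| < 2·atan(1/4)` and `V ≤ c_max` for all `t ≥ 0`, every bus-angle
difference tends to the equilibrium's and every machine frequency deviation tends to `0`. CERTIFIED for MODEL M′_D, CLASS slab
`u = 1/4`, `γ_lo = 97/200`, rank-one level (`s = 261305/128` uniform); MODELLED / VALIDATED as in the header.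
[cite: Pai1981, §2.16 Theorem [18] and §4.6–§4.7; VuTuritsyn2017, §4.1 and §4.3 Theorem 1] -/
theorem ne39_slab_roa_rankOne {y : (Fin 49 → ℝ) × (Fin 49 → ℝ)}
    (hy : ∀ e, |(y.1 (srcV e) - y.1 (tgtV e)) - (δ₀ (srcV e) - δ₀ (tgtV e))| ≤ (97 : ℝ) / 200)
    (hyc : cert.V (relState ref gnode δ₀ y) ≤ (18818 : ℝ) / 163315625) :
    (∃ X : ℝ → (Fin 49 → ℝ) × (Fin 49 → ℝ), X 0 = y ∧
        ∀ T : ℝ, ∀ t ∈ Icc 0 T, HasDerivWithinAt X ((NE39SP.params D).phaseField (X t)) (Icc 0 T) t) ∧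
      ∀ X : ℝ → (Fin 49 → ℝ) × (Fin 49 → ℝ), X 0 = y →
        (∀ T : ℝ, ∀ t ∈ Icc 0 T, HasDerivWithinAt X ((NE39SP.params D).phaseField (X t)) (Icc 0 T) t) →
        (∀ t, 0 ≤ t →
            (∀ e, |((X t).1 (srcV e) - (X t).1 (tgtV e)) - (δ₀ (srcV e) - δ₀ (tgtV e))|
              < 2 * Real.arctan ((1 / 4 : ℚ) : ℝ)) ∧
            cert.V (relState ref gnode δ₀ (X t)) ≤ (18818 : ℝ) / 163315625) ∧
          (∀ v w, Tendsto (fun t => (X t).1 v - (X t).1 w) atTop (𝓝 (δ₀ v - δ₀ w))) ∧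
          ∀ v ∈ genS, Tendsto (fun t => (X t).2 v) atTop (𝓝 0) := by
  have ha : ∀ e, cert.a e ≤ (slabSlope (1 / 4) : ℝ) := fun e => by
    show ((aSQ : ℚ) : ℝ) ≤ ((slabSlope (1 / 4) : ℚ) : ℝ)
    exact_mod_cast (show aSQ ≤ slabSlope (1 / 4) by norm_num [aSQ, slabSlope, tauLF])
  have hb1 : ∀ e, (1 : ℝ) ≤ cert.b e := fun _ => le_refl _
  have hs0 : ∀ e : Fin 56, (0 : ℝ) < (fun _ : Fin 56 => ((sS : ℚ) : ℝ)) e := fun _ => by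
    show (0 : ℝ) < ((sS : ℚ) : ℝ)
    exact_mod_cast rank_scalar_facts.1
  have hc : ∀ e : Fin 56, ((cMaxS : ℚ) : ℝ) * (fun _ : Fin 56 => ((sS : ℚ) : ℝ)) e ≤ (((97 / 200 : ℚ)) : ℝ) ^ 2 :=
    fun _ => by
    show ((cMaxS : ℚ) : ℝ) * ((sS : ℚ) : ℝ) ≤ (((97 / 200 : ℚ)) : ℝ) ^ 2
    have h2 : cMaxS * sS ≤ (97 / 200 : ℚ) ^ 2 := by
      have := rank_scalar_facts.2
      simp only [gammaLoS] at this
      exact this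
    exact_mod_cast h2
  have hlev : ((cMaxS : ℚ) : ℝ) = (18818 : ℝ) / 163315625 := by norm_num [cMaxS]
  have hglo : (((97 / 200 : ℚ)) : ℝ) = (97 : ℝ) / 200 := by norm_num
  have hy' : ∀ e, |(y.1 (srcV e) - y.1 (tgtV e)) - (δ₀ (srcV e) - δ₀ (tgtV e))| ≤ (((97 / 200 : ℚ)) : ℝ) :=
    fun e => by rw [hglo]; exact hy e
  have hyc' : cert.V (relState ref gnode δ₀ y) ≤ ((cMaxS : ℚ) : ℝ) := by rw [hlev]; exact hyc
  have h := NE39SP.slab_roa_of_rankOne hD cert (u := 1 / 4) (γlo := 97 / 200) (by norm_num) (by norm_num)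
    (by norm_num) (by norm_num) ha hb1 (s := fun _ : Fin 56 => ((sS : ℚ) : ℝ)) hs0 rankOne_facts
    (c := ((cMaxS : ℚ) : ℝ)) hc hy' hyc'
  rw [hlev] at h
  exact h

end Summit.Ventures.GridStability.Bench.NE39SPSlabC

end
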